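import Literature.MathematicalPhysics.QuantumLattice.MatsubaraTruncationRemainder
import Literature.Analysis.Fourier.SquareWaveSineSeries
import HarnessLib

/-!
# The truncated Matsubara representation of the free propagator, II: bounded pointwise convergence

Topic `Literature/MathematicalPhysics/QuantumLattice`; the `M → ∞` ("Matsubara UV") limit of the truncated
fermionic frequency representation of the free one-mode propagator, in the tree's conventions
(`MatsubaraIdx M = Fin (2M)`, `ωᵢ = π(2n+1)/β`, `n ∈ [-M, M)`, propagator `1/(iω − ξ)` as in
`MatsubaraTruncationMidpoint.tendsto_truncatedTadpole`).  With

  `g_M(τ) = (1/β) Σᵢ e^{-iωᵢτ}/(iωᵢ − ξ)`,   `n_F(ξ) = (1 + e^{βξ})⁻¹`,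

this file proves, for `β > 0` and every real `ξ`:

* `truncatedPropagator_eq_squareWave_add_remainder` — the split
  `g_M(τ) = -(2/π) S_M(πτ/β) + R_M(τ)`, `S_M(x) = Σ_{n<M} sin((2n+1)x)/(2n+1)` the square-wave partial sum
  (`Literature.Analysis.Fourier.SquareWaveSineSeries`), `R_M` the continuous remainder of part I
  (`MatsubaraTruncationRemainder`);
* `norm_truncatedPropagator_le` — the UNIFORM bound `‖g_M(τ)‖ ≤ 2 + β|ξ|/3` (all `M`, all real `τ`);
* `tendsto_truncatedPropagator_of_mem_Ioo` — for `0 < τ < β`,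
  `g_M(τ) → -e^{-ξτ}/(1 + e^{-βξ}) = -(1 − n_F(ξ)) e^{-ξτ}`;
* `tendsto_truncatedPropagator_of_mem_Ioo_neg` — for `-β < τ < 0`,
  `g_M(τ) → e^{-ξτ}/(1 + e^{βξ}) = n_F(ξ) e^{-ξτ}`;
* the same in the BGM convention `ĝ(k₀) = 1/(-ik₀ + ξ)` (`…_bgm`): limits `(1 − n_F)e^{-ξτ}` (`τ > 0`) and
  `-n_F e^{-ξτ}` (`τ < 0`), i.e. `⟨T a(τ)a⁺(0)⟩`, the time-ordered propagator of
  Benfatto–Giuliani–Mastropietro (2.3)–(2.4); at `τ = 0` the limit is the midpoint (part of the tree already).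

Together with the uniform bound this is exactly what dominated convergence needs to pass to the limit
`M → ∞` in time-integrated determinant / Gram expressions built from truncated propagators (the bridge from
the finite-`M` Grassmann representation `HubbardFreeCovariance` to Hamiltonian traces).  Everything is
proved; no definitions, no named facts.

## Sources

G. Benfatto, A. Giuliani, V. Mastropietro, Ann. Henri Poincaré 7 (2006) 809–898, §2.1 (2.3)–(2.4)
[`BenfattoGiulianiMastropietro2006`]; A. Giuliani, V. Mastropietro, Commun. Math. Phys. 293 (2010) 301–346,
App. A (A.19)–(A.21) [`GiulianiMastropietro2010`]; A. L. Fetter, J. D. Walecka, *Quantum Theory of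
Many-Particle Systems* (1971), §25 (frequency sums and the convergence factor). [folklore]
-/

noncomputable section

namespace Literature.MathematicalPhysics.QuantumLattice

open Finset Filter Complex _root_.Topology
open scoped Real

/-! ### The square-wave part `(1/β) Σᵢ e^{-iωᵢτ}/(iωᵢ) = -(2/π) S_M(πτ/β)` -/

/-- Pairing `ω ↔ -ω`: `e^{-iωτ}/(iω) + e^{iωτ}/(-iω) = -2 sin(ωτ)/ω` (also at `ω = 0`, where both sides
vanish). [folklore] -/
theorem exp_div_I_mul_add_neg (ω τ : ℝ) :
    cexp (-(I * ω * τ)) * (1 / (I * ω)) + cexp (-(I * (-ω : ℝ) * τ)) * (1 / (I * (-ω : ℝ))) =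
      ((-2 * Real.sin (ω * τ) / ω : ℝ) : ℂ) := by
  rcases eq_or_ne ω 0 with rfl | hω
  · simp
  have hω' : (ω : ℂ) ≠ 0 := by exact_mod_cast hω
  have hI : I * (ω : ℂ) ≠ 0 := mul_ne_zero I_ne_zero hω'
  have hs : cexp (-(I * ω * τ)) - cexp (I * ω * τ) = -2 * I * Complex.sin ((ω : ℂ) * τ) := by
    have h := Complex.two_sin ((ω : ℂ) * τ)
    rw [show -(I * (ω : ℂ) * τ) = -((ω : ℂ) * τ) * I by ring, show I * (ω : ℂ) * τ = (ω : ℂ) * τ * I by ring]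
    linear_combination I * h + (cexp (-((ω : ℂ) * τ) * I) - cexp ((ω : ℂ) * τ * I)) * I_mul_I
  push_cast
  have e2 : cexp (-(I * -(ω : ℂ) * τ)) * (1 / (I * -(ω : ℂ))) = -(cexp (I * ω * τ) * (1 / (I * ω))) := by
    rw [show -(I * -(ω : ℂ) * τ) = I * ω * τ by ring, show I * -(ω : ℂ) = -(I * ω) by ring,
      one_div_neg_eq_neg_one_div, mul_neg]
  rw [e2, ← sub_eq_add_neg, ← sub_mul, hs]
  field_simp

/-- **The square-wave part of the truncated propagator**: `(1/β) Σᵢ e^{-iωᵢτ}/(iωᵢ) = -(2/π) S_M(πτ/β)`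
with `S_M(x) = Σ_{n<M} sin((2n+1)x)/(2n+1)` (`β ≠ 0`). [folklore] -/
theorem truncatedSquareWave_eq {β : ℝ} (hβ : β ≠ 0) (τ : ℝ) (M : ℕ) :
    (1 / (β : ℂ)) * ∑ i : MatsubaraIdx M, cexp (-(I * matsubaraFreq β M i * τ)) * (1 / (I * matsubaraFreq β M i)) =
      ((-(2 / π) * ∑ n ∈ range M, Real.sin ((2 * n + 1) * (π * τ / β)) / (2 * n + 1) : ℝ) : ℂ) := by
  rw [sum_matsubaraIdx_freq_eq_sum_range β M (fun ω : ℝ => cexp (-(I * ω * τ)) * (1 / (I * ω))),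
    ← Finset.sum_add_distrib]
  have hterm : ∀ n : ℕ, (fun ω : ℝ => cexp (-(I * ω * τ)) * (1 / (I * ω))) ((2 * n + 1) * π / β) +
      (fun ω : ℝ => cexp (-(I * ω * τ)) * (1 / (I * ω))) (-((2 * n + 1) * π / β)) =
      ((-2 * Real.sin ((2 * n + 1) * π / β * τ) / ((2 * n + 1) * π / β) : ℝ) : ℂ) :=
    fun n => exp_div_I_mul_add_neg _ _
  rw [Finset.sum_congr rfl fun n _ => hterm n]
  push_cast
  rw [Finset.mul_sum, Finset.mul_sum]
  refine Finset.sum_congr rfl fun n _ => ?_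
  have hn : ((2 : ℂ) * n + 1) ≠ 0 := by
    have : (0 : ℝ) < 2 * n + 1 := by positivity
    exact_mod_cast this.ne'
  have hπ : (π : ℂ) ≠ 0 := by exact_mod_cast Real.pi_ne_zero
  have hβ' : (β : ℂ) ≠ 0 := by exact_mod_cast hβ
  rw [show ((2 : ℂ) * n + 1) * π / β * τ = (2 * n + 1) * (π * τ / β) by ring]
  field_simp

/-! ### The split and the uniform bound -/

/-- **The truncated propagator is square wave plus remainder**:
`(1/β) Σᵢ e^{-iωᵢτ}/(iωᵢ − ξ) = -(2/π) S_M(πτ/β) + (1/β) Σᵢ e^{-iωᵢτ}(1/(iωᵢ − ξ) − 1/(iωᵢ))`. [folklore] -/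
theorem truncatedPropagator_eq_squareWave_add_remainder {β : ℝ} (hβ : β ≠ 0) (ξ τ : ℝ) (M : ℕ) :
    (1 / (β : ℂ)) * ∑ i : MatsubaraIdx M, cexp (-(I * matsubaraFreq β M i * τ)) *
        (1 / (I * matsubaraFreq β M i - ξ)) =
      ((-(2 / π) * ∑ n ∈ range M, Real.sin ((2 * n + 1) * (π * τ / β)) / (2 * n + 1) : ℝ) : ℂ) +
        (1 / (β : ℂ)) * ∑ i : MatsubaraIdx M, cexp (-(I * matsubaraFreq β M i * τ)) *
          (1 / (I * matsubaraFreq β M i - ξ) - 1 / (I * matsubaraFreq β M i)) := by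
  rw [← truncatedSquareWave_eq hβ τ M, ← mul_add, ← Finset.sum_add_distrib]
  congr 1
  refine Finset.sum_congr rfl fun i _ => ?_
  ring

/-- **Uniform bound on the truncated propagator**: `‖(1/β) Σᵢ e^{-iωᵢτ}/(iωᵢ − ξ)‖ ≤ 2 + β|ξ|/3` for every
`M` and every real `τ` (`β > 0`): `(2/π)·3` from the square wave
(`Literature.Analysis.Fourier.abs_sum_sin_odd_div_le_three`) plus `β|ξ|/3` from the remainder
(`norm_truncatedRemainder_le`). [folklore] -/
theorem norm_truncatedPropagator_le {β : ℝ} (hβ : 0 < β) (ξ τ : ℝ) (M : ℕ) :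
    ‖(1 / (β : ℂ)) * ∑ i : MatsubaraIdx M, cexp (-(I * matsubaraFreq β M i * τ)) *
        (1 / (I * matsubaraFreq β M i - ξ))‖ ≤ 2 + β * |ξ| / 3 := by
  rw [truncatedPropagator_eq_squareWave_add_remainder hβ.ne' ξ τ M]
  refine (norm_add_le _ _).trans (add_le_add ?_ (norm_truncatedRemainder_le hβ ξ τ M))
  rw [Complex.norm_real, Real.norm_eq_abs, abs_mul, abs_neg, abs_div, abs_two, abs_of_pos Real.pi_pos]
  have h3 := Literature.Analysis.Fourier.abs_sum_sin_odd_div_le_three M (π * τ / β)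
  have hπ : 2 / π ≤ 2 / 3 := div_le_div_of_nonneg_left zero_le_two (by norm_num) Real.pi_gt_three.le
  calc 2 / π * |∑ n ∈ range M, Real.sin ((2 * n + 1) * (π * τ / β)) / (2 * n + 1)|
      ≤ 2 / 3 * 3 := mul_le_mul hπ h3 (abs_nonneg _) (by norm_num)
    _ = 2 := by norm_num

/-! ### The pointwise limits -/

/-- **The truncated Matsubara representation converges to the time-ordered propagator, `0 < τ < β`**:
`(1/β) Σᵢ e^{-iωᵢτ}/(iωᵢ − ξ) → -e^{-ξτ}/(1 + e^{-βξ}) = -(1 − n_F(ξ)) e^{-ξτ}` as `M → ∞` (`β > 0`).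
[cite: BenfattoGiulianiMastropietro2006, §2.1 (2.3)-(2.4)] -/
theorem tendsto_truncatedPropagator_of_mem_Ioo {β : ℝ} (hβ : 0 < β) (ξ : ℝ) {τ : ℝ} (hτ : τ ∈ Set.Ioo 0 β) :
    Tendsto (fun M : ℕ => (1 / (β : ℂ)) * ∑ i : MatsubaraIdx M, cexp (-(I * matsubaraFreq β M i * τ)) *
        (1 / (I * matsubaraFreq β M i - ξ)))
      atTop (𝓝 ((-((1 + Real.exp (-(β * ξ)))⁻¹ * Real.exp (-(ξ * τ))) : ℝ) : ℂ)) := by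
  have hx : 0 < Real.sin (π * τ / β) := by
    refine Real.sin_pos_of_pos_of_lt_pi (by have := hτ.1; positivity) ?_
    rw [div_lt_iff₀ hβ]
    nlinarith [hτ.2, Real.pi_pos]
  have h1 := Literature.Analysis.Fourier.tendsto_sum_sin_odd_div_of_sin_pos hx
  have h1' : Tendsto (fun M : ℕ => ((-(2 / π) * ∑ n ∈ range M,
      Real.sin ((2 * n + 1) * (π * τ / β)) / (2 * n + 1) : ℝ) : ℂ)) atTop (𝓝 (((-(2 / π) * (π / 4)) : ℝ) : ℂ)) :=
    (Complex.continuous_ofReal.tendsto _).comp (h1.const_mul (-(2 / π)))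
  have h2 := tendsto_truncatedRemainder_of_mem_Icc hβ ξ (Set.Ioo_subset_Icc_self hτ)
  have h := h1'.add h2
  have hval : (((-(2 / π) * (π / 4)) : ℝ) : ℂ) +
      (((1 / 2 - (1 + Real.exp (-(β * ξ)))⁻¹ * Real.exp (-(ξ * τ))) : ℝ) : ℂ) =
      ((-((1 + Real.exp (-(β * ξ)))⁻¹ * Real.exp (-(ξ * τ))) : ℝ) : ℂ) := by
    rw [← Complex.ofReal_add]
    congr 1
    field_simp
    ring
  rw [hval] at h
  refine h.congr fun M => ?_
  rw [truncatedPropagator_eq_squareWave_add_remainder hβ.ne' ξ τ M]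

/-- **The truncated Matsubara representation converges to the time-ordered propagator, `-β < τ < 0`**:
`(1/β) Σᵢ e^{-iωᵢτ}/(iωᵢ − ξ) → e^{-ξτ}/(1 + e^{βξ}) = n_F(ξ) e^{-ξτ}` as `M → ∞` (`β > 0`).
[cite: BenfattoGiulianiMastropietro2006, §2.1 (2.3)-(2.4)] -/
theorem tendsto_truncatedPropagator_of_mem_Ioo_neg {β : ℝ} (hβ : 0 < β) (ξ : ℝ) {τ : ℝ}
    (hτ : τ ∈ Set.Ioo (-β) 0) :
    Tendsto (fun M : ℕ => (1 / (β : ℂ)) * ∑ i : MatsubaraIdx M, cexp (-(I * matsubaraFreq β M i * τ)) *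
        (1 / (I * matsubaraFreq β M i - ξ)))
      atTop (𝓝 ((((1 + Real.exp (β * ξ))⁻¹ * Real.exp (-(ξ * τ))) : ℝ) : ℂ)) := by
  have hx : Real.sin (π * τ / β) < 0 := by
    refine Real.sin_neg_of_neg_of_neg_pi_lt ?_ ?_
    · rw [div_neg_iff]; right; exact ⟨by nlinarith [hτ.2, Real.pi_pos], hβ⟩
    · rw [lt_div_iff₀ hβ]
      nlinarith [hτ.1, Real.pi_pos]
  have h1 := Literature.Analysis.Fourier.tendsto_sum_sin_odd_div_of_sin_neg hx
  have h1' : Tendsto (fun M : ℕ => ((-(2 / π) * ∑ n ∈ range M,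
      Real.sin ((2 * n + 1) * (π * τ / β)) / (2 * n + 1) : ℝ) : ℂ)) atTop
      (𝓝 (((-(2 / π) * (-(π / 4))) : ℝ) : ℂ)) :=
    (Complex.continuous_ofReal.tendsto _).comp (h1.const_mul (-(2 / π)))
  have h2 := tendsto_truncatedRemainder_of_mem_Icc_neg hβ ξ (Set.Ioo_subset_Icc_self hτ)
  have h := h1'.add h2
  have hval : (((-(2 / π) * (-(π / 4))) : ℝ) : ℂ) +
      ((((1 + Real.exp (β * ξ))⁻¹ * Real.exp (-(ξ * τ)) - 1 / 2) : ℝ) : ℂ) =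
      ((((1 + Real.exp (β * ξ))⁻¹ * Real.exp (-(ξ * τ))) : ℝ) : ℂ) := by
    rw [← Complex.ofReal_add]
    congr 1
    field_simp
    ring
  rw [hval] at h
  refine h.congr fun M => ?_
  rw [truncatedPropagator_eq_squareWave_add_remainder hβ.ne' ξ τ M]

/-! ### The BGM convention `ĝ(k₀) = 1/(-ik₀ + ξ)` -/

/-- Conversion between the two conventions: `1/(-iω + ξ) = -(1/(iω − ξ))` termwise. [folklore] -/
theorem truncatedPropagator_bgm_eq_neg (β ξ τ : ℝ) (M : ℕ) :
    (1 / (β : ℂ)) * ∑ i : MatsubaraIdx M, cexp (-(I * matsubaraFreq β M i * τ)) *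
        (1 / (-(I * matsubaraFreq β M i) + ξ)) =
      -((1 / (β : ℂ)) * ∑ i : MatsubaraIdx M, cexp (-(I * matsubaraFreq β M i * τ)) *
        (1 / (I * matsubaraFreq β M i - ξ))) := by
  rw [← mul_neg, ← Finset.sum_neg_distrib]
  congr 1
  refine Finset.sum_congr rfl fun i _ => ?_
  rw [show -(I * (matsubaraFreq β M i : ℂ)) + ξ = -(I * matsubaraFreq β M i - ξ) by ring,
    one_div_neg_eq_neg_one_div, mul_neg]

/-- **BGM convention, `0 < τ < β`**: `(1/β) Σᵢ e^{-iωᵢτ}/(-iωᵢ + ξ) → e^{-ξτ}/(1 + e^{-βξ}) = (1 − n_F(ξ))e^{-ξτ}`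
(`= ⟨a(τ)a⁺(0)⟩`, Benfatto–Giuliani–Mastropietro 2006 (2.3)–(2.4); `nambuPropagator_zero_seed`).
[cite: BenfattoGiulianiMastropietro2006, §2.1 (2.3)-(2.4)] -/
theorem tendsto_truncatedPropagator_bgm_of_mem_Ioo {β : ℝ} (hβ : 0 < β) (ξ : ℝ) {τ : ℝ}
    (hτ : τ ∈ Set.Ioo 0 β) :
    Tendsto (fun M : ℕ => (1 / (β : ℂ)) * ∑ i : MatsubaraIdx M, cexp (-(I * matsubaraFreq β M i * τ)) *
        (1 / (-(I * matsubaraFreq β M i) + ξ)))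
      atTop (𝓝 ((((1 + Real.exp (-(β * ξ)))⁻¹ * Real.exp (-(ξ * τ))) : ℝ) : ℂ)) := by
  have h := (tendsto_truncatedPropagator_of_mem_Ioo hβ ξ hτ).neg
  rw [← Complex.ofReal_neg, neg_neg] at h
  refine h.congr fun M => ?_
  rw [truncatedPropagator_bgm_eq_neg]

/-- **BGM convention, `-β < τ < 0`**: `(1/β) Σᵢ e^{-iωᵢτ}/(-iωᵢ + ξ) → -e^{-ξτ}/(1 + e^{βξ}) = -n_F(ξ)e^{-ξτ}`
(`= -⟨a⁺(0)a(τ)⟩`, the fermionic sign of time ordering). [cite: BenfattoGiulianiMastropietro2006, §2.1 (2.3)-(2.4)] -/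
theorem tendsto_truncatedPropagator_bgm_of_mem_Ioo_neg {β : ℝ} (hβ : 0 < β) (ξ : ℝ) {τ : ℝ}
    (hτ : τ ∈ Set.Ioo (-β) 0) :
    Tendsto (fun M : ℕ => (1 / (β : ℂ)) * ∑ i : MatsubaraIdx M, cexp (-(I * matsubaraFreq β M i * τ)) *
        (1 / (-(I * matsubaraFreq β M i) + ξ)))
      atTop (𝓝 ((-((1 + Real.exp (β * ξ))⁻¹ * Real.exp (-(ξ * τ))) : ℝ) : ℂ)) := by
  have h := (tendsto_truncatedPropagator_of_mem_Ioo_neg hβ ξ hτ).neg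
  rw [← Complex.ofReal_neg] at h
  refine h.congr fun M => ?_
  rw [truncatedPropagator_bgm_eq_neg]

/-- **Uniform bound, BGM convention**: `‖(1/β) Σᵢ e^{-iωᵢτ}/(-iωᵢ + ξ)‖ ≤ 2 + β|ξ|/3`. [folklore] -/
theorem norm_truncatedPropagator_bgm_le {β : ℝ} (hβ : 0 < β) (ξ τ : ℝ) (M : ℕ) :
    ‖(1 / (β : ℂ)) * ∑ i : MatsubaraIdx M, cexp (-(I * matsubaraFreq β M i * τ)) *
        (1 / (-(I * matsubaraFreq β M i) + ξ))‖ ≤ 2 + β * |ξ| / 3 := by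
  rw [truncatedPropagator_bgm_eq_neg, norm_neg]
  exact norm_truncatedPropagator_le hβ ξ τ M

end Literature.MathematicalPhysics.QuantumLattice
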